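import Summits.NavierStokesRegularity.FunctionalMining.TopEigGapCutoffEstimate
import HarnessLib

/-!
# FunctionalMining — PROPOSITION L-λ(η) AT `q = 2` IN THE KERNEL ON THE WHOLE TOP-GAP CLASS:
# `(2π²η/9) · Φ₂(v) ≤ T₂(v)` whenever `λ₂ ≤ (1−η)λ₁`; the node `TopEigGapCoerciveTwo η` HOLDS

Search for candidate a priori estimates; no regularity claim. Cell `pub-nsfunc`, prove seat
(gen 26). Step (iv) of the kernel plan for the dictionary's `@[conjecture]` node `TopEigGapCoerciveTwo η`
/ `TopEigGapCoercivePos 2 η` (`TopEigHeatCoerciveGap.lean`; the no-go seat's Proposition L-λ(η),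
SIEVELD §3.4b (4), pen): the zeros of the strain. `TopEigGapCoerciveSimple` (gen 25) proved
`(2π²η²/27)Φ₂ ≤ T₂` for fields of the class whose top eigenvalue is simple EVERYWHERE; on the class this
excludes exactly the fields whose strain vanishes somewhere, where `λ₁` and `P₁ = e₁ ⊗ e₁` are not smooth.

THE CUT-OFF ARGUMENT (this file; `G = G_δ = cutRamp δ`, `g = G' ∈ [0,1]`, `G = 0` on `(−∞, δ]`,
`s − 2δ ≤ G(s) ≤ s` for `s ≥ 0`; `M^δ = G(λ₁)·P₁`, `F^δ_k = G(λ₁)∂ₖλ₁` — GLOBALLY smooth on the class,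
`TopEigGapCutoffSmooth`; `μ = μ(S;S(Δv))` the Danskin density):
1. HEAT SIDE. Danskin (`heatDissipation_topEigMoment_eq_integral`, no simplicity needed):
   `T₂ = −∫2λ₁μ`. The cut-off channel density `ρ^δ = 2(∑ₖ∂ₖF^δ_k − G(λ₁)μ)` integrates to `−2∫G(λ₁)μ`
   (`∫∂ₖF^δ_k = 0`), so `∫ρ^δ = T₂ + 2∫(λ₁ − G(λ₁))μ ≤ T₂ + 4δ ∫‖S(Δv)‖`; and `ρ^δ ≥ 0` pointwise
   (`= 2gA + 4GR` at simple points by the R-form of `Δλ₁`, `= 0` where `λ₁ < δ`; `TopEigGapCutoffDeriv`).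
2. GRADIENT SIDE. `∑ₖᵢⱼ(∂ₖM^δᵢⱼ)² ≤ (1/(2η))ρ^δ` pointwise (`TopEigGapCutoffDeriv`), hence
   `∑ᵢⱼ‖∇M^δᵢⱼ‖₂² ≤ (1/(2η))(T₂ + 4δC)`, `C = ∫‖S(Δv)‖`.
3. POINCARÉ entrywise (`four_pi_sq_mul_integral_sq_sub_mean_le`): `4π² D_δ ≤ ∑ᵢⱼ‖∇M^δᵢⱼ‖₂²`,
   `D_δ = ∑ᵢⱼ∫(M^δᵢⱼ − mean)²`.
4. MOMENT SIDE. `∑ᵢⱼSᵢⱼM^δᵢⱼ = G(λ₁)λ₁` and `∫Sᵢⱼ = 0`, so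
   `Φ₂ − 2δ∫λ₁ ≤ ∫G(λ₁)λ₁ = ∫S:(M^δ − mean) ≤ ∫6λ₁|M^δ − mean| ≤ 6 Φ₂^{1/2} D_δ^{1/2}`
   (`|S|² ≤ 36λ₁²`, Hölder) — `cut_topEigMoment_two_estimate` (steps 1–4 are the file
   `TopEigGapCutoffEstimate`).
5. `δ → 0` (THIS file): `Φ₂ ≤ 6Φ₂^{1/2}(T₂/(8π²η))^{1/2}`, i.e. **`(2π²η/9)·Φ₂ ≤ T₂`**
   (`topEigMoment_two_le_heatDissipation_of_gap`; `T₂ ≥ 0` by the heat sieve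
   `heatDissipation_nonneg_of_admissible`).

CONSEQUENCES (namespace `Summit.NavierStokesRegularity.FunctionalMining.TopEig`):
* `topEigHeatCoerciveOnGap_two (0 < η ≤ 1) : TopEigHeatCoerciveOnGap 2 η (2π²η/9)`;
* **`topEigGapCoerciveTwo_holds (0 < η ≤ 1) : TopEigGapCoerciveTwo (d := Fin 3) η`** — the node AS
  TYPED (its constant `topGapRateTwo η = 4π²η/(6(1+√3)²) ≈ 0.88η` is below `2π²η/9 ≈ 2.19η`);
* **`topEigGapCoercivePos_two (0 < η) : TopEigGapCoercivePos (d := Fin 3) 2 η`** (for `η > 1` the class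
  is smaller than the class `η = 1`).
The constant improves gen 25's `2π²η²/27` (one factor `1/(λ₁−κ_b) ≤ 1/(ηλ₁)` instead of two, and the
weight `λ₁` of the R-form kept). NOT CLAIMED: anything at `q ≠ 2`, any value of the best constant, the
one-sided node `TopEigHeatCoercivePos 2` (fields outside every gap class), Navier–Stokes regularity.
[ours; the no-go seat's Proposition L-λ(η) (pen, SIEVELD §3.4b (4)) at `q = 2`, now kernel]
-/

noncomputable section

open Filter Topology Matrix Finset MeasureTheory
open scoped ContDiff

namespace Summit.NavierStokesRegularity.FunctionalMining

open Literature.Analysis Literature.Analysis.FunctionSpaces Literature.Analysis.FunctionSpaces.Torus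
  SharpClass.DirectorForm Literature.Analysis.Matrix

namespace TopEig

variable {v : UnitAddTorus (Fin 3) → EuclideanSpace ℝ (Fin 3)}

/-! ## 1. `δ → 0`: Proposition L-λ(η) at `q = 2` on the whole class -/

/-- **PROPOSITION L-λ(η) AT `q = 2`, KERNEL FORM, WHOLE TOP-GAP CLASS.** For `v` smooth and divergence
free on `T³`, `0 < η ≤ 1`, and `λ₂(x) ≤ (1 − η)λ₁(x)` at every `x` (zeros of the strain allowed):
`(2π²η/9) · Φ₂(v) ≤ heatDissipation Φ₂ v = T₂(v)`. [ours; the no-go seat's Proposition L-λ(η)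
(SIEVELD §3.4b (4), pen) at `q = 2`, kernel, with the constant `2π²η/9 ≥ 4π²η/(6(1+√3)²)`] -/
theorem topEigMoment_two_le_heatDissipation_of_gap (hv : Torus.IsSmooth v)
    (hdiv : Torus.IsDivFree v) {η : ℝ} (hη0 : 0 < η) (hη1 : η ≤ 1)
    (hgap : ∀ x : UnitAddTorus (Fin 3), torusStrainMidEig v x ≤ (1 - η) * torusStrainTopEig v x) :
    2 * Real.pi ^ 2 * η / 9 * torusTopEigMoment 2 v ≤ heatDissipation (torusTopEigMoment 2) v := by
  set F : ℝ := torusTopEigMoment 2 v with hFdef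
  set T : ℝ := heatDissipation (torusTopEigMoment 2) v with hTdef
  set L : ℝ := ∫ x, torusStrainTopEig v x with hLdef
  set C : ℝ := ∫ x, ‖StrainL4.strainFlat (Torus.laplacian v) x‖ with hCdef
  set K : ℝ := (4 * Real.pi ^ 2)⁻¹ * (1 / (2 * η)) with hKdef
  have hK0 : 0 ≤ K := by positivity
  have hT0 : 0 ≤ T :=
    heatDissipation_nonneg_of_admissible (q := 2) (by norm_num) convexOn_lam lipschitzWith_lam
      (fun _ hv hdiv x => lam_strainFlat_nonneg hv hdiv x)
      (fun _ hv hdiv => torusTopEigMoment_eq hv hdiv 2) hv hdiv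
  have hF0 : 0 ≤ F := torusTopEigMoment_nonneg 2 v
  -- the family of estimates, `δ > 0`
  have hfam : ∀ δ : ℝ, 0 < δ →
      F - 2 * δ * L ≤ 6 * (Real.sqrt F * Real.sqrt (K * (T + 4 * δ * C))) := by
    intro δ hδ
    have h := cut_topEigMoment_two_estimate hv hdiv hη0 hη1 hgap hδ
    have e : (4 * Real.pi ^ 2)⁻¹ * (1 / (2 * η) * (T + 4 * δ * C)) = K * (T + 4 * δ * C) := by
      rw [hKdef]; ring
    rw [← e]
    exact h
  -- limits as `δ → 0⁺`
  have hlim1 : Tendsto (fun δ : ℝ => F - 2 * δ * L) (𝓝[>] 0) (𝓝 F) := by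
    have hc : Continuous fun δ : ℝ => F - 2 * δ * L := by continuity
    have h := hc.tendsto 0
    simp only [mul_zero, zero_mul, sub_zero] at h
    exact h.mono_left nhdsWithin_le_nhds
  have hlim2 : Tendsto (fun δ : ℝ => 6 * (Real.sqrt F * Real.sqrt (K * (T + 4 * δ * C))))
      (𝓝[>] 0) (𝓝 (6 * (Real.sqrt F * Real.sqrt (K * T)))) := by
    have hc : Continuous fun δ : ℝ => 6 * (Real.sqrt F * Real.sqrt (K * (T + 4 * δ * C))) :=
      continuous_const.mul (continuous_const.mul
        ((continuous_const.mul (continuous_const.add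
          ((continuous_const.mul continuous_id).mul continuous_const))).sqrt))
    have h := hc.tendsto 0
    simp only [mul_zero, zero_mul, add_zero] at h
    exact h.mono_left nhdsWithin_le_nhds
  have hev : ∀ᶠ δ in 𝓝[>] (0 : ℝ),
      F - 2 * δ * L ≤ 6 * (Real.sqrt F * Real.sqrt (K * (T + 4 * δ * C))) :=
    eventually_nhdsWithin_of_forall fun δ hδ => hfam δ hδ
  have hmain : F ≤ 6 * (Real.sqrt F * Real.sqrt (K * T)) := le_of_tendsto_of_tendsto hlim1 hlim2 hev
  -- `F ≤ 36 K T`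
  have hKT0 : 0 ≤ K * T := mul_nonneg hK0 hT0
  have hF36 : F ≤ 36 * (K * T) := by
    set s : ℝ := Real.sqrt F with hs
    set r : ℝ := Real.sqrt (K * T) with hr
    have hs0 : 0 ≤ s := Real.sqrt_nonneg _
    have hr0 : 0 ≤ r := Real.sqrt_nonneg _
    have hFsq : F = s ^ 2 := (Real.sq_sqrt hF0).symm
    have hKTsq : K * T = r ^ 2 := (Real.sq_sqrt hKT0).symm
    rw [hFsq] at hmain ⊢
    rw [hKTsq]
    rcases hs0.eq_or_lt with h0 | hpos
    · rw [← h0]; nlinarith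
    · have h1 : s * s ≤ s * (6 * r) := by nlinarith
      have h2 : s ≤ 6 * r := le_of_mul_le_mul_left h1 hpos
      nlinarith
  -- constants: `36 K = 9/(2π²η)`
  have hπ2 : 0 < Real.pi ^ 2 := by positivity
  have e : 36 * (K * T) = 9 / (2 * Real.pi ^ 2 * η) * T := by
    rw [hKdef]
    field_simp
    ring
  rw [e] at hF36
  calc 2 * Real.pi ^ 2 * η / 9 * F
      ≤ 2 * Real.pi ^ 2 * η / 9 * (9 / (2 * Real.pi ^ 2 * η) * T) :=
        mul_le_mul_of_nonneg_left hF36 (by positivity)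
    _ = T := by field_simp

/-! ## 2. The dictionary's node -/

/-- **`TopEigHeatCoerciveOnGap 2 η (2π²η/9)`** for `0 < η ≤ 1`: heat coercivity of `Φ₂` at rate
`2π²η/9` on the whole top-gap class `λ₂ ≤ (1−η)λ₁`. [ours] -/
theorem topEigHeatCoerciveOnGap_two {η : ℝ} (hη0 : 0 < η) (hη1 : η ≤ 1) :
    TopEigHeatCoerciveOnGap (d := Fin 3) 2 η (2 * Real.pi ^ 2 * η / 9) := by
  intro _ v hv hdiv _ hcls
  exact topEigMoment_two_le_heatDissipation_of_gap hv hdiv hη0 hη1 hcls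

/-- The paper constant is below ours: `4π²η/(6(1+√3)²) ≤ 2π²η/9` for `η ≥ 0`
(`(1+√3)² = 4 + 2√3 ≥ 3`). [ours, bookkeeping] -/
theorem topGapRateTwo_le {η : ℝ} (hη : 0 ≤ η) : topGapRateTwo η ≤ 2 * Real.pi ^ 2 * η / 9 := by
  unfold topGapRateTwo
  have h3 : 0 ≤ Real.sqrt 3 := Real.sqrt_nonneg 3
  have hsq : Real.sqrt 3 ^ 2 = 3 := Real.sq_sqrt (by norm_num)
  have h6 : 0 < 6 * (1 + Real.sqrt 3) ^ 2 := by positivity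
  rw [div_le_div_iff₀ h6 (by norm_num)]
  have hπ2 : 0 ≤ Real.pi ^ 2 * η := by positivity
  nlinarith

/-- **THE NODE `TopEigGapCoerciveTwo η` HOLDS for every `0 < η ≤ 1`** — Proposition L-λ(η) at `q = 2`
AS TYPED by the dictionary (`TopEigHeatCoerciveGap.lean`, `@[conjecture]`; rate `topGapRateTwo η =
4π²η/(6(1+√3)²)`), now a kernel theorem on the whole class, zeros of the strain included. [ours; the
no-go seat's Proposition L-λ(η) (SIEVELD §3.4b (4)), kernel] -/
theorem topEigGapCoerciveTwo_holds {η : ℝ} (hη0 : 0 < η) (hη1 : η ≤ 1) :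
    TopEigGapCoerciveTwo (d := Fin 3) η :=
  (topEigHeatCoerciveOnGap_two hη0 hη1).mono (topGapRateTwo_le hη0.le)

/-- **`TopEigGapCoercivePos 2 η` for every `η > 0`** (existential form of Proposition L-λ(η) at
`q = 2`; for `η > 1` the class is contained in the class `η = 1`). [ours] -/
theorem topEigGapCoercivePos_two {η : ℝ} (hη0 : 0 < η) : TopEigGapCoercivePos (d := Fin 3) 2 η := by
  rcases le_or_gt η 1 with h | h
  · exact (topEigGapCoerciveTwo_holds hη0 h).pos hη0
  · have h1 : TopEigGapCoercivePos (d := Fin 3) 2 1 := (topEigGapCoerciveTwo_holds one_pos le_rfl).pos one_pos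
    exact h1.of_le_eta h.le

/-- The node for `1 < η ≤ 2` as well (the class shrinks with `η`; `topGapRateTwo η ≤ 2π²/9` there).
[ours, bookkeeping] -/
theorem topEigGapCoerciveTwo_holds_of_le_two {η : ℝ} (hη0 : 0 < η) (hη2 : η ≤ 2) :
    TopEigGapCoerciveTwo (d := Fin 3) η := by
  rcases le_or_gt η 1 with h | h
  · exact topEigGapCoerciveTwo_holds hη0 h
  · have h1 := topEigHeatCoerciveOnGap_two (η := 1) one_pos le_rfl
    have h2 : TopEigHeatCoerciveOnGap (d := Fin 3) 2 η (2 * Real.pi ^ 2 * 1 / 9) := h1.of_le_eta h.le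
    refine h2.mono ?_
    unfold topGapRateTwo
    have h3 : 1 ≤ Real.sqrt 3 := by
      rw [show (1 : ℝ) = Real.sqrt 1 by rw [Real.sqrt_one]]
      exact Real.sqrt_le_sqrt (by norm_num)
    have hsq : Real.sqrt 3 ^ 2 = 3 := Real.sq_sqrt (by norm_num)
    have h6 : 0 < 6 * (1 + Real.sqrt 3) ^ 2 := by positivity
    rw [div_le_div_iff₀ h6 (by norm_num)]
    have hπ2 : 0 ≤ Real.pi ^ 2 := by positivity
    nlinarith

end TopEig

end Summit.NavierStokesRegularity.FunctionalMining

end
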